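import Summits.QuantumFields.YangMills.Theorems.BalabanUVNodesN15BackgroundMatrixByPartsNodeTwoSided
import Summits.QuantumFields.YangMills.Theorems.BalabanUVNodesN15FullPropagatorMatrixByPartsNode
import HarnessLib

/-!
# ★★★ `T4EtaRate.NE2PlusOperator` BY NAME FOR BAŁABAN's FULL `U ≡ 1` PROPAGATOR ⊗ 1_𝔤 DRESSED BY A LIVE TWO-SIDED NON-ABELIAN FIRST-ORDER BACKGROUND `M_C + Σ_μ[M_{A_μ}∇_μ +
# M_{B_μ}∇⁻_μ]` — the shape of (3.52)'s `V′₁(A)`, BOTH bond orientations — all four (3.42) entries constructed, entry 2 by parts, NO mixed piece; §4 HYPOTHESIS-FREE (dag-n15-c g9,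
# FILE 21; Track-A node N15 = NE2, s1 «background-layer OPERATOR ingredient»)

`--kind proof --supports stmt-QuantumFields-20544 --as helper` (K3⁷; count-neutral).  Imports BY NAME this seat's FILE 20 `…N15BackgroundMatrixByPartsNodeTwoSided`
(`ne2PlusOperator_byParts_matrix₂`; through it FILE 19 `coeffBgMBP₂` ∕ `bgInstanceMBP₂` ∕ `bgFamilyMBP₂`, FILE 18 `e0_comp_fgradAdj_eq_e2ByParts_matrix₂`) and FILE 16
`…N15FullPropagatorMatrixByPartsNode` (`fgD`-lifted family, ★★ `uniform_layer_fullGM` — the thirteen forward letters incl. FILE 15's shift-defect row letter; through it FILE 15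
`fgrad_liftEquiv_comp` ∕ `idef_comp_fgradAdj_liftEquiv`, M4 `tensorId` ∕ `hasMaj_tensorId` ∕ `idef_tensorId`, FILE 8 `le_rate`, part 71 `hasMaj_twoGridDefect_div`, FILE 4
`symbOp_sD_eq` ∕ `symbOp_sTinv_sub_one_eq`, g7 G5 `…N15FullPropagatorBackwardEntry`: ★★ `hasMaj_twoGridDefect_grad_backward`, `hasMaj_gradBack_pair`, W1 `bshiftV`; FILE 18 `bgrad_comp_gOp_eq` ∕ `bgrad_liftEquiv_comp`); nothing in the
tree is modified.

WHAT.  §1 `dPiecesM₂` (the lifted derived pieces over `J ⊕ J`: forward `(∇_μG) ⊗ 1` on `inl`, backward `(∇⁻_μG) ⊗ 1` on `inr`), `fgInstanceM₂`, `fgFamilyM₂` (FILE 19's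
`bgInstanceMBP₂` ∕ `bgFamilyMBP₂` over the unit-torus carrier with King's pairing at `G = gOp ⊗ 1`; backward pieces `(bgrad n (bshiftEquiv μ) ∘ gOp) ⊗ 1` — FILE 18 §4).  §2 ★★ `uniform_layer_fullGM₂`: the thirteen UNIFORM `U ≡ 1` letters of FILE 20 at
this family, ALL tree theorems — FILE 16's thirteen (constants widened) plus, on the `inr` pieces, G5's backward majorants and η-defect tensored with `1_ι`.  §3 ★★★
`ne2PlusOperator_fullGM₂_byParts_of_entry2`, ★★★ **`ne2PlusOperator_fullGM₂_byParts`** — HYPOTHESIS-FREE with part 71 (`γ = 1∕(8(d+1))`, `d ≥ 1`), `_dim4`.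

HONEST FRAMING ∕ LIMITS.  `T4EtaRate.NE2PlusOperator` BY NAME, NO DISPLAYED BINDER, for the GENUINE `U ≡ 1` propagator `gOp ⊗ 1_𝔤` on the torus family of record dressed by a LIVE
two-sided non-abelian first-order background whose matrix coefficient fields `C`, `A_μ` (forward), `B_μ` (backward) are FREE data admitted by FILE 19's (3.35)–(3.36)-shaped entrywise
letters (MODEL species: not yet derived from ONE gauge field through `ad`-polynomials `Phi1∕Phi2(η, ad A)` as in (3.52); entrywise-linearised (C3) transport); NO (3.44) mixed letter.
NE2⁺ as printed NOT PRINTED, NOT proved, not claimed; count-neutral (typed 28∕28 · discharged 5∕27 of record unchanged); N15 NOT discharged; one finite T⁴ at fixed ε — NOT ℝ⁴, NOT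
infinite volume, NOT OS, NOT a mass gap, NOT Clay.
-/

noncomputable section

open scoped BigOperators
open Finset

namespace Summit.QuantumFields.YangMills.BalabanUVNodes.N15.BackgroundLayer

open Literature.MathematicalPhysics.QuantumFieldTheory.Balaban1983to89
open Literature.MathematicalPhysics.QuantumFieldTheory.Balaban1983to89.B11SectG (BlockNorm HasMaj RowSum)
open Literature.MathematicalPhysics.QuantumFieldTheory.Balaban1983to89.T4EtaRate (PairedInstance NE2PlusOperator rateFactor)
open Literature.MathematicalPhysics.QuantumFieldTheory.Balaban1983to89.T4EtaRateDefect (idef idef_apply rateWeight)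
open Literature.MathematicalPhysics.QuantumFieldTheory.Balaban1983to89.T4EtaRateCoeffDefect (pull pull_apply diagK diagK_nonneg)
open Literature.MathematicalPhysics.QuantumFieldTheory.Balaban1983to89.B5Prop11Plancherel (Tor fine unitVec)
open Literature.MathematicalPhysics.QuantumFieldTheory.Balaban1983to89.B5SiteBridgeP12 (MP)
open Literature.MathematicalPhysics.QuantumFieldTheory.Balaban1983to89.B6UnitTorusCarrier (unitTorusGeo triangle254_unitTorusGeo rowSum_unitTorusGeo unitTorusGeo_dist_nonneg
  unitTorusGeo_len)
open Literature.MathematicalPhysics.QuantumFieldTheory.King1986.Torus (blockOf tdistT tdistT_nonneg tdistT_self)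
open Summit.QuantumFields.YangMills.BalabanUVNodes.N15.MatrixSpecies (mmulOp liftMap liftBlk liftEquiv liftEquiv_apply liftEquiv_symm_apply)
open Summit.QuantumFields.YangMills.BalabanUVNodes.N15.TwoGrid (gOp symbOp sT sTinv sD sLap paramsOf hasMaj_rate_mono hasMaj_twoGridDefect_div TGIndex TGIndex.Mn)
open Summit.QuantumFields.YangMills.BalabanUVNodes.N15.VectorPiece (blkFine kingPrV blkFine_comp_kingPrV bshiftEquiv bshiftEquiv_apply bshiftEquiv_symm_apply bshiftV bshiftV_apply
  tensorId tensorId_apply hasMaj_tensorId idef_tensorId)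
open Summit.QuantumFields.YangMills.BalabanUVNodes.N15.GenuineSite (hasMaj_twoGridDefect_grad_backward hasMaj_gradBack_pair)

variable {d : ℕ} {L : ℕ} [NeZero L]

/-! ## §1 The realised two-sided matrix by-parts family at `gOp ⊗ 1_𝔤` -/

section Family

variable (d) (ι : Type) [Fintype ι] [DecidableEq ι]

/-- THE LIFTED DERIVED PIECES OVER THE DOUBLED DIRECTION SET: forward `(∇_μG) ⊗ 1` on `inl μ`, backward `(∇⁻_μG) ⊗ 1` on `inr μ`. [cite: Balaban1985BackgroundPropagators, (3.52) p.400 (both orientations: shape)] -/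
def dPiecesM₂ (M : Fin (d + 1) → ℕ) [∀ μ, NeZero (M μ)] (n : ℕ) [NeZero n] (b : ℝ) :
    Fin (d + 1) ⊕ Fin (d + 1) → ((Tor (fine n M) × Fin (d + 1)) × ι → ℝ) →ₗ[ℝ] ((Tor (fine n M) × Fin (d + 1)) × ι → ℝ) :=
  fun j => Sum.elim (fun μ => tensorId ι (fgD d M n b μ)) (fun μ => tensorId ι (bgrad (n : ℝ) (bshiftEquiv M n μ) ∘ₗ gOp M n b)) j

/-- THE REALISED PAIRED INSTANCE at `(i, ν)`, rate exponent `γ`, colour components `ι`: FILE 19's `bgInstanceMBP₂` over the unit-torus carrier (King's pairing, translations `bshiftEquiv`,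
`θ = (L^k)^{−γ}`), arguments = `𝔤 ≅ ℝ^ι`-valued 1-forms. [cite: Balaban1985BackgroundPropagators, Thm 3.14 pp.426–427 (typing template); Balaban1984PropagatorsII, (2.156) p.250 (shape)] -/
def fgInstanceM₂ (hL : Odd L ∧ 1 < L) (γ : ℝ) (i : TGIndex × Fin (d + 1)) : PairedInstance :=
  bgInstanceMBP₂ (Fin (d + 1)) ι (g := unitTorusGeo L i.1.k (TGIndex.Mn d hL i.1)) (blkFine L i.1.k (TGIndex.Mn d hL i.1)) (kingPrV L i.1.k i.1.m (TGIndex.Mn d hL i.1))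
    (fun μ => bshiftEquiv (TGIndex.Mn d hL i.1) (L ^ i.1.k) μ) (fun μ => bshiftEquiv (TGIndex.Mn d hL i.1) (L ^ i.1.m * L ^ i.1.k) μ) ((L ^ i.1.k : ℕ) : ℝ)
    ((L ^ i.1.m * L ^ i.1.k : ℕ) : ℝ) i.1.m (Nat.cast_ne_zero.mpr (NeZero.ne L)) (((L : ℝ) ^ i.1.k) ^ (-γ)) (((L : ℝ) ^ i.1.k) ^ (-γ))

/-- THE REALISED TWO-SIDED MATRIX BY-PARTS KERNEL FAMILY at `(i, ν)`: FILE 19's `bgFamilyMBP₂` with `G = gOp ⊗ 1_ι`, derived pieces `dPiecesM₂` (forward AND backward), `D₃ = (ΔG) ⊗ 1_ι`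
at both spacings — all four (3.42) entries CONSTRUCTED, entry 2 BY PARTS, two-sided matrix coefficient species. [cite: Balaban1985BackgroundPropagators, (3.42) p.397 + (3.52) p.400 (shapes)] -/
def fgFamilyM₂ (hL : Odd L ∧ 1 < L) (b γ : ℝ) (i : TGIndex × Fin (d + 1)) : B9.KernelFamily (fgInstanceM₂ d ι hL γ i).gc (fgInstanceM₂ d ι hL γ i).Bf :=
  bgFamilyMBP₂ (J := Fin (d + 1)) (ι := ι) (g := unitTorusGeo L i.1.k (TGIndex.Mn d hL i.1)) (blkFine L i.1.k (TGIndex.Mn d hL i.1))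
    (kingPrV L i.1.k i.1.m (TGIndex.Mn d hL i.1)) (fun μ => bshiftEquiv (TGIndex.Mn d hL i.1) (L ^ i.1.k) μ)
    (fun μ => bshiftEquiv (TGIndex.Mn d hL i.1) (L ^ i.1.m * L ^ i.1.k) μ) ((L ^ i.1.k : ℕ) : ℝ) ((L ^ i.1.m * L ^ i.1.k : ℕ) : ℝ) i.1.m (Nat.cast_ne_zero.mpr (NeZero.ne L))
    (((L : ℝ) ^ i.1.k) ^ (-γ)) (((L : ℝ) ^ i.1.k) ^ (-γ)) i.2
    (tensorId ι (gOp (TGIndex.Mn d hL i.1) (L ^ i.1.k) b))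
    (tensorId ι (symbOp (TGIndex.Mn d hL i.1) (L ^ i.1.k) (sLap (TGIndex.Mn d hL i.1) (L ^ i.1.k) ((L ^ i.1.k : ℕ) : ℝ)) ∘ₗ gOp (TGIndex.Mn d hL i.1) (L ^ i.1.k) b))
    (dPiecesM₂ d ι (TGIndex.Mn d hL i.1) (L ^ i.1.k) b)
    (tensorId ι (gOp (TGIndex.Mn d hL i.1) (L ^ i.1.m * L ^ i.1.k) b))
    (tensorId ι (symbOp (TGIndex.Mn d hL i.1) (L ^ i.1.m * L ^ i.1.k) (sLap (TGIndex.Mn d hL i.1) (L ^ i.1.m * L ^ i.1.k) ((L ^ i.1.m * L ^ i.1.k : ℕ) : ℝ)) ∘ₗ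
      gOp (TGIndex.Mn d hL i.1) (L ^ i.1.m * L ^ i.1.k) b))
    (dPiecesM₂ d ι (TGIndex.Mn d hL i.1) (L ^ i.1.m * L ^ i.1.k) b)

omit [Fintype ι] [DecidableEq ι] in
/-- the `inl` pieces ARE the lifted forward quotients of the lifted piece (FILE 18's `hDf`). [folklore] -/
theorem dPiecesM₂_inl (M : Fin (d + 1) → ℕ) [∀ μ, NeZero (M μ)] (n : ℕ) [NeZero n] (b : ℝ) (μ : Fin (d + 1)) :
    dPiecesM₂ d ι M n b (Sum.inl μ) = fgrad (n : ℝ) (liftEquiv (bshiftEquiv M n μ) ι) ∘ₗ tensorId ι (gOp M n b) := by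
  rw [dPiecesM₂, Sum.elim_inl, tensorId_fgD_eq]

omit [Fintype ι] [DecidableEq ι] in
/-- the `inr` pieces ARE the lifted backward quotients of the lifted piece (FILE 18's `hDb`). [folklore] -/
theorem dPiecesM₂_inr (M : Fin (d + 1) → ℕ) [∀ μ, NeZero (M μ)] (n : ℕ) [NeZero n] (b : ℝ) (μ : Fin (d + 1)) :
    dPiecesM₂ d ι M n b (Sum.inr μ) = bgrad (n : ℝ) (liftEquiv (bshiftEquiv M n μ) ι) ∘ₗ tensorId ι (gOp M n b) := by
  rw [dPiecesM₂, Sum.elim_inr, bgrad_liftEquiv_comp]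

end Family

/-! ## §2 The UNIFORM `U ≡ 1` letters of the two-sided family at `gOp ⊗ 1_ι` — every one a tree theorem -/

section Letters

variable (d) (ι : Type) [Fintype ι] [DecidableEq ι] [Nonempty ι]

omit [DecidableEq ι] in
/-- ★★ **THE UNIFORM `U ≡ 1` LETTERS OF THE TWO-SIDED MATRIX BY-PARTS FAMILY AT BAŁABAN's FULL PROPAGATOR ⊗ 1_𝔤**, all tree theorems: FILE 16 `uniform_layer_fullGM`'s thirteen (constants
widened by monotonicity) and, on the BACKWARD derived pieces `(∇⁻_μG) ⊗ 1` (`inr μ`), G5's (1.110) majorants at both spacings (`hasMaj_gradBack_pair`) and two-grid η-defect (exponent `1∕16 ≥ γ`,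
`hasMaj_twoGridDefect_grad_backward`) tensored with `1_ι`. [cite: Balaban1984PropagatorsI, Prop. 1.2 (1.110)–(1.111) p.35; Balaban1984PropagatorsII, (2.156) p.250; King1986, p.664 (pairing)] -/
theorem uniform_layer_fullGM₂ (hLodd : Odd L) (hL2 : 2 ≤ L) (hL : Odd L ∧ 1 < L) {b : ℝ} (hb : 0 < b) {γ : ℝ} (hγ0 : 0 < γ) (hγ1 : γ ≤ 1 / 16) (c35 : ℝ)
    {δ₂ B₂ : ℝ} (hδ₂ : 0 < δ₂) (hB₂ : 0 ≤ B₂) :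
    ∃ δ β m₀ cT mT : ℝ, 0 < δ ∧ δ ≤ δ₂ ∧ 0 < β ∧ 0 < m₀ ∧ B₂ ≤ m₀ ∧ 0 < cT ∧ 0 < mT ∧ ∀ i : TGIndex × Fin (d + 1),
      HasMaj (BlockNorm.ofBlocks (unitTorusGeo L i.1.k (TGIndex.Mn d hL i.1)) (liftBlk (blkFine L i.1.k (TGIndex.Mn d hL i.1)) ι))
          (BlockNorm.ofBlocks (unitTorusGeo L i.1.k (TGIndex.Mn d hL i.1)) (liftBlk (blkFine L i.1.k (TGIndex.Mn d hL i.1)) ι))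
          (tensorId ι (gOp (TGIndex.Mn d hL i.1) (L ^ i.1.k) b)) (fun y y' => β * Real.exp (-(δ * (unitTorusGeo L i.1.k (TGIndex.Mn d hL i.1)).dist y y'))) ∧
      (∀ μ, HasMaj (BlockNorm.ofBlocks (unitTorusGeo L i.1.k (TGIndex.Mn d hL i.1)) (liftBlk (blkFine L i.1.k (TGIndex.Mn d hL i.1)) ι))
          (BlockNorm.ofBlocks (unitTorusGeo L i.1.k (TGIndex.Mn d hL i.1)) (liftBlk (blkFine L i.1.k (TGIndex.Mn d hL i.1)) ι))
          (dPiecesM₂ d ι (TGIndex.Mn d hL i.1) (L ^ i.1.k) b μ) (fun y y' => β * Real.exp (-(δ * (unitTorusGeo L i.1.k (TGIndex.Mn d hL i.1)).dist y y')))) ∧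
      HasMaj (BlockNorm.ofBlocks (unitTorusGeo L i.1.k (TGIndex.Mn d hL i.1)) (liftBlk (blkFine L i.1.k (TGIndex.Mn d hL i.1) ∘ kingPrV L i.1.k i.1.m (TGIndex.Mn d hL i.1)) ι))
          (BlockNorm.ofBlocks (unitTorusGeo L i.1.k (TGIndex.Mn d hL i.1)) (liftBlk (blkFine L i.1.k (TGIndex.Mn d hL i.1) ∘ kingPrV L i.1.k i.1.m (TGIndex.Mn d hL i.1)) ι))
          (tensorId ι (gOp (TGIndex.Mn d hL i.1) (L ^ i.1.m * L ^ i.1.k) b)) (fun y y' => β * Real.exp (-(δ * (unitTorusGeo L i.1.k (TGIndex.Mn d hL i.1)).dist y y'))) ∧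
      (∀ μ, HasMaj (BlockNorm.ofBlocks (unitTorusGeo L i.1.k (TGIndex.Mn d hL i.1)) (liftBlk (blkFine L i.1.k (TGIndex.Mn d hL i.1) ∘ kingPrV L i.1.k i.1.m (TGIndex.Mn d hL i.1)) ι))
          (BlockNorm.ofBlocks (unitTorusGeo L i.1.k (TGIndex.Mn d hL i.1)) (liftBlk (blkFine L i.1.k (TGIndex.Mn d hL i.1) ∘ kingPrV L i.1.k i.1.m (TGIndex.Mn d hL i.1)) ι))
          (dPiecesM₂ d ι (TGIndex.Mn d hL i.1) (L ^ i.1.m * L ^ i.1.k) b μ) (fun y y' => β * Real.exp (-(δ * (unitTorusGeo L i.1.k (TGIndex.Mn d hL i.1)).dist y y')))) ∧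
      HasMaj (BlockNorm.ofBlocks (unitTorusGeo L i.1.k (TGIndex.Mn d hL i.1)) (liftBlk (blkFine L i.1.k (TGIndex.Mn d hL i.1) ∘ kingPrV L i.1.k i.1.m (TGIndex.Mn d hL i.1)) ι))
          (BlockNorm.ofBlocks (unitTorusGeo L i.1.k (TGIndex.Mn d hL i.1)) (liftBlk (blkFine L i.1.k (TGIndex.Mn d hL i.1) ∘ kingPrV L i.1.k i.1.m (TGIndex.Mn d hL i.1)) ι))
          (tensorId ι (symbOp (TGIndex.Mn d hL i.1) (L ^ i.1.m * L ^ i.1.k) (sLap (TGIndex.Mn d hL i.1) (L ^ i.1.m * L ^ i.1.k) ((L ^ i.1.m * L ^ i.1.k : ℕ) : ℝ)) ∘ₗ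
            gOp (TGIndex.Mn d hL i.1) (L ^ i.1.m * L ^ i.1.k) b)) (fun y y' => β * Real.exp (-(δ * (unitTorusGeo L i.1.k (TGIndex.Mn d hL i.1)).dist y y'))) ∧
      HasMaj (BlockNorm.ofBlocks (unitTorusGeo L i.1.k (TGIndex.Mn d hL i.1)) (liftBlk (blkFine L i.1.k (TGIndex.Mn d hL i.1)) ι))
          (BlockNorm.ofBlocks (unitTorusGeo L i.1.k (TGIndex.Mn d hL i.1)) (liftBlk (blkFine L i.1.k (TGIndex.Mn d hL i.1) ∘ kingPrV L i.1.k i.1.m (TGIndex.Mn d hL i.1)) ι))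
          (idef (pull (liftMap (kingPrV L i.1.k i.1.m (TGIndex.Mn d hL i.1)) ι)) (pull (liftMap (kingPrV L i.1.k i.1.m (TGIndex.Mn d hL i.1)) ι))
            (tensorId ι (gOp (TGIndex.Mn d hL i.1) (L ^ i.1.m * L ^ i.1.k) b)) (tensorId ι (gOp (TGIndex.Mn d hL i.1) (L ^ i.1.k) b)))
          (fun y y' => m₀ * ((L : ℝ) ^ i.1.k) ^ (-γ) * Real.exp (-(δ * (unitTorusGeo L i.1.k (TGIndex.Mn d hL i.1)).dist y y'))) ∧
      (∀ μ, HasMaj (BlockNorm.ofBlocks (unitTorusGeo L i.1.k (TGIndex.Mn d hL i.1)) (liftBlk (blkFine L i.1.k (TGIndex.Mn d hL i.1)) ι))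
          (BlockNorm.ofBlocks (unitTorusGeo L i.1.k (TGIndex.Mn d hL i.1)) (liftBlk (blkFine L i.1.k (TGIndex.Mn d hL i.1) ∘ kingPrV L i.1.k i.1.m (TGIndex.Mn d hL i.1)) ι))
          (idef (pull (liftMap (kingPrV L i.1.k i.1.m (TGIndex.Mn d hL i.1)) ι)) (pull (liftMap (kingPrV L i.1.k i.1.m (TGIndex.Mn d hL i.1)) ι))
            (dPiecesM₂ d ι (TGIndex.Mn d hL i.1) (L ^ i.1.m * L ^ i.1.k) b μ) (dPiecesM₂ d ι (TGIndex.Mn d hL i.1) (L ^ i.1.k) b μ))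
          (fun y y' => m₀ * ((L : ℝ) ^ i.1.k) ^ (-γ) * Real.exp (-(δ * (unitTorusGeo L i.1.k (TGIndex.Mn d hL i.1)).dist y y')))) ∧
      HasMaj (BlockNorm.ofBlocks (unitTorusGeo L i.1.k (TGIndex.Mn d hL i.1)) (liftBlk (blkFine L i.1.k (TGIndex.Mn d hL i.1)) ι))
          (BlockNorm.ofBlocks (unitTorusGeo L i.1.k (TGIndex.Mn d hL i.1)) (liftBlk (blkFine L i.1.k (TGIndex.Mn d hL i.1) ∘ kingPrV L i.1.k i.1.m (TGIndex.Mn d hL i.1)) ι))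
          (idef (pull (liftMap (kingPrV L i.1.k i.1.m (TGIndex.Mn d hL i.1)) ι)) (pull (liftMap (kingPrV L i.1.k i.1.m (TGIndex.Mn d hL i.1)) ι))
            (tensorId ι (symbOp (TGIndex.Mn d hL i.1) (L ^ i.1.m * L ^ i.1.k) (sLap (TGIndex.Mn d hL i.1) (L ^ i.1.m * L ^ i.1.k) ((L ^ i.1.m * L ^ i.1.k : ℕ) : ℝ)) ∘ₗ
              gOp (TGIndex.Mn d hL i.1) (L ^ i.1.m * L ^ i.1.k) b))
            (tensorId ι (symbOp (TGIndex.Mn d hL i.1) (L ^ i.1.k) (sLap (TGIndex.Mn d hL i.1) (L ^ i.1.k) ((L ^ i.1.k : ℕ) : ℝ)) ∘ₗ gOp (TGIndex.Mn d hL i.1) (L ^ i.1.k) b)))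
          (fun y y' => m₀ * ((L : ℝ) ^ i.1.k) ^ (-γ) * Real.exp (-(δ * (unitTorusGeo L i.1.k (TGIndex.Mn d hL i.1)).dist y y'))) ∧
      (∀ ν, HasMaj (BlockNorm.ofBlocks (unitTorusGeo L i.1.k (TGIndex.Mn d hL i.1)) (liftBlk (blkFine L i.1.k (TGIndex.Mn d hL i.1)) ι))
          (BlockNorm.ofBlocks (unitTorusGeo L i.1.k (TGIndex.Mn d hL i.1)) (liftBlk (blkFine L i.1.k (TGIndex.Mn d hL i.1)) ι))
          (tensorId ι (gOp (TGIndex.Mn d hL i.1) (L ^ i.1.k) b) ∘ₗ fgradAdj ((L ^ i.1.k : ℕ) : ℝ) (liftEquiv (bshiftEquiv (TGIndex.Mn d hL i.1) (L ^ i.1.k) ν) ι))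
          (fun y y' => β * Real.exp (-(δ * (unitTorusGeo L i.1.k (TGIndex.Mn d hL i.1)).dist y y')))) ∧
      (∀ ν, HasMaj (BlockNorm.ofBlocks (unitTorusGeo L i.1.k (TGIndex.Mn d hL i.1)) (liftBlk (blkFine L i.1.k (TGIndex.Mn d hL i.1) ∘ kingPrV L i.1.k i.1.m (TGIndex.Mn d hL i.1)) ι))
          (BlockNorm.ofBlocks (unitTorusGeo L i.1.k (TGIndex.Mn d hL i.1)) (liftBlk (blkFine L i.1.k (TGIndex.Mn d hL i.1) ∘ kingPrV L i.1.k i.1.m (TGIndex.Mn d hL i.1)) ι))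
          (tensorId ι (gOp (TGIndex.Mn d hL i.1) (L ^ i.1.m * L ^ i.1.k) b) ∘ₗ
            fgradAdj ((L ^ i.1.m * L ^ i.1.k : ℕ) : ℝ) (liftEquiv (bshiftEquiv (TGIndex.Mn d hL i.1) (L ^ i.1.m * L ^ i.1.k) ν) ι))
          (fun y y' => β * Real.exp (-(δ * (unitTorusGeo L i.1.k (TGIndex.Mn d hL i.1)).dist y y')))) ∧
      (∀ μ, HasMaj (BlockNorm.ofBlocks (unitTorusGeo L i.1.k (TGIndex.Mn d hL i.1)) (liftBlk (blkFine L i.1.k (TGIndex.Mn d hL i.1)) ι))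
          (BlockNorm.ofBlocks (unitTorusGeo L i.1.k (TGIndex.Mn d hL i.1)) (liftBlk (blkFine L i.1.k (TGIndex.Mn d hL i.1)) ι))
          (pull ⇑(liftEquiv (bshiftEquiv (TGIndex.Mn d hL i.1) (L ^ i.1.k) μ) ι)) (fun y y' => cT * Real.exp (-(δ * (unitTorusGeo L i.1.k (TGIndex.Mn d hL i.1)).dist y y')))) ∧
      (∀ μ, HasMaj (BlockNorm.ofBlocks (unitTorusGeo L i.1.k (TGIndex.Mn d hL i.1)) (liftBlk (blkFine L i.1.k (TGIndex.Mn d hL i.1) ∘ kingPrV L i.1.k i.1.m (TGIndex.Mn d hL i.1)) ι))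
          (BlockNorm.ofBlocks (unitTorusGeo L i.1.k (TGIndex.Mn d hL i.1)) (liftBlk (blkFine L i.1.k (TGIndex.Mn d hL i.1) ∘ kingPrV L i.1.k i.1.m (TGIndex.Mn d hL i.1)) ι))
          (pull ⇑(liftEquiv (bshiftEquiv (TGIndex.Mn d hL i.1) (L ^ i.1.m * L ^ i.1.k) μ) ι))
          (fun y y' => cT * Real.exp (-(δ * (unitTorusGeo L i.1.k (TGIndex.Mn d hL i.1)).dist y y')))) ∧
      (∀ (U : (Tor (fine (L ^ i.1.m * L ^ i.1.k) (TGIndex.Mn d hL i.1)) × Fin (d + 1) → Matrix ι ι ℝ) ×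
            (Fin (d + 1) ⊕ Fin (d + 1) → Tor (fine (L ^ i.1.m * L ^ i.1.k) (TGIndex.Mn d hL i.1)) × Fin (d + 1) → Matrix ι ι ℝ)) (α₀ : ℝ),
          (coeffBgMBP₂ (Fin (d + 1)) ι (kingPrV L i.1.k i.1.m (TGIndex.Mn d hL i.1)) (fun μ => bshiftEquiv (TGIndex.Mn d hL i.1) (L ^ i.1.k) μ)
            (fun μ => bshiftEquiv (TGIndex.Mn d hL i.1) (L ^ i.1.m * L ^ i.1.k) μ) ((L ^ i.1.k : ℕ) : ℝ) ((L ^ i.1.m * L ^ i.1.k : ℕ) : ℝ)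
            (unitTorusGeo L i.1.k (TGIndex.Mn d hL i.1)).M (((L : ℝ) ^ i.1.k) ^ (-γ))).Reg335 c35 α₀ U →
        ∀ μ, HasMaj (BlockNorm.ofBlocks (unitTorusGeo L i.1.k (TGIndex.Mn d hL i.1)) (liftBlk (liftBlk (blkFine L i.1.k (TGIndex.Mn d hL i.1)) ι) (Fin (d + 1))))
          (BlockNorm.ofBlocks (unitTorusGeo L i.1.k (TGIndex.Mn d hL i.1)) (liftBlk (blkFine L i.1.k (TGIndex.Mn d hL i.1) ∘ kingPrV L i.1.k i.1.m (TGIndex.Mn d hL i.1)) ι))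
          (idef (pull (liftMap (kingPrV L i.1.k i.1.m (TGIndex.Mn d hL i.1)) ι)) (pull (liftMap (kingPrV L i.1.k i.1.m (TGIndex.Mn d hL i.1)) ι))
              (pull ⇑(liftEquiv (bshiftEquiv (TGIndex.Mn d hL i.1) (L ^ i.1.m * L ^ i.1.k) μ) ι)) (pull ⇑(liftEquiv (bshiftEquiv (TGIndex.Mn d hL i.1) (L ^ i.1.k) μ) ι)) ∘ₗ
            (mmulOp ((avgM₁ (Fin (d + 1) ⊕ Fin (d + 1)) ι (kingPrV L i.1.k i.1.m (TGIndex.Mn d hL i.1)) U).2 (Sum.inl μ) ∘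
                ⇑(bshiftEquiv (TGIndex.Mn d hL i.1) (L ^ i.1.k) μ).symm) ∘ₗ
              sumJ fun ν => tensorId ι (gOp (TGIndex.Mn d hL i.1) (L ^ i.1.k) b) ∘ₗ
                fgradAdj ((L ^ i.1.k : ℕ) : ℝ) (liftEquiv (bshiftEquiv (TGIndex.Mn d hL i.1) (L ^ i.1.k) ν) ι)))
          (fun y y' => mT * (c35 * (unitTorusGeo L i.1.k (TGIndex.Mn d hL i.1)).M * α₀ * Fintype.card ι) * ((L : ℝ) ^ i.1.k) ^ (-γ) *
            Real.exp (-(δ * (unitTorusGeo L i.1.k (TGIndex.Mn d hL i.1)).dist y y')))) := by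
  have hL0 : 0 < L := by omega
  have hLr : (0 : ℝ) ≤ (L : ℝ) := Nat.cast_nonneg _
  have hLr1 : (1 : ℝ) ≤ (L : ℝ) := by exact_mod_cast (show 1 ≤ L by omega)
  have hγlt1 : γ < 1 := by linarith
  -- FILE 15: the shift-defect row letter; G5: the backward pieces' majorants and η-defect
  obtain ⟨δ₄, C₄, hδ₄, hC₄, H4⟩ := hasMaj_shiftDefect_fullGM (d := d) ι hLodd hL2 hb hγ0.le hγlt1
  obtain ⟨δb, Cb, hδb, hCb, Hb⟩ := hasMaj_gradBack_pair (d := d) hL2 hL hb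
  obtain ⟨δbd, Cbd, hδbd, hCbd, Hbd⟩ := hasMaj_twoGridDefect_grad_backward (d := d) hLodd hL2 hb
  -- FILE 16's forward letters, at a rate below FILE 15's and G5's and with `m₀ ≥ max B₂ C_bd`
  obtain ⟨δ, β, m₀, cT, _mT₀, hδ, hδδ, hβ, hm₀, hBm, hcT, -, H⟩ :=
    uniform_layer_fullGM d ι hLodd hL2 hL hb hγ0 hγ1 c35 (lt_min (lt_min hδ₂ hδ₄) (lt_min hδb hδbd)) (le_max_of_le_left hB₂ : (0 : ℝ) ≤ max B₂ Cbd)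
  have hδ₂' : δ ≤ δ₂ := hδδ.trans ((min_le_left _ _).trans (min_le_left _ _))
  have hδ₄' : δ ≤ δ₄ := hδδ.trans ((min_le_left _ _).trans (min_le_right _ _))
  have hδb' : δ ≤ δb := hδδ.trans ((min_le_right _ _).trans (min_le_left _ _))
  have hδbd' : δ ≤ δbd := hδδ.trans ((min_le_right _ _).trans (min_le_right _ _))
  have hB₂m : B₂ ≤ m₀ := (le_max_left _ _).trans hBm
  have hCbdm : Cbd ≤ m₀ := (le_max_right _ _).trans hBm
  refine ⟨δ, β + Cb, m₀, cT, 2 * C₄, hδ, hδ₂', by positivity, hm₀, hB₂m, hcT, by positivity, fun i => ?_⟩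
  obtain ⟨hG, hD, hG', hD', hD₃', hDG, hDD, hDD₃, hS, hS', hSh, hSh', -⟩ := H i
  -- widening `β ↦ β + C_b` of a forward letter
  have hwide : ∀ {F₁ F₂ : Type} [AddCommGroup F₁] [Module ℝ F₁] [AddCommGroup F₂] [Module ℝ F₂]
      {b₁ : BlockNorm (unitTorusGeo L i.1.k (TGIndex.Mn d hL i.1)) F₁} {b₂ : BlockNorm (unitTorusGeo L i.1.k (TGIndex.Mn d hL i.1)) F₂} {T : F₁ →ₗ[ℝ] F₂},
      HasMaj b₁ b₂ T (fun y y' => β * Real.exp (-(δ * (unitTorusGeo L i.1.k (TGIndex.Mn d hL i.1)).dist y y'))) →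
      HasMaj b₁ b₂ T (fun y y' => (β + Cb) * Real.exp (-(δ * (unitTorusGeo L i.1.k (TGIndex.Mn d hL i.1)).dist y y'))) := fun h =>
    h.mono fun y y' => mul_le_mul_of_nonneg_right (by linarith) (Real.exp_nonneg _)
  obtain ⟨⟨mT', k, hk, m⟩, ν⟩ := i
  simp only at hG hD hG' hD' hD₃' hDG hDD hDD₃ hS hS' hSh hSh' hwide ⊢
  have hx1 : (1 : ℝ) ≤ (L : ℝ) ^ k := one_le_pow₀ hLr1
  have hxθ : 0 ≤ ((L : ℝ) ^ k) ^ (-γ) := Real.rpow_nonneg (by positivity) _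
  have hcast : ((L ^ k : ℕ) : ℝ) = (L : ℝ) ^ k := by push_cast; ring
  have hd0 : ∀ y y' : Tor (TGIndex.Mn d hL ⟨mT', k, hk, m⟩), 0 ≤ tdistT (TGIndex.Mn d hL ⟨mT', k, hk, m⟩) y y' := fun y y' => tdistT_nonneg _ _ _
  have hβK : ∀ y y' : Tor (TGIndex.Mn d hL ⟨mT', k, hk, m⟩), 0 ≤ (β + Cb) * Real.exp (-(δ * tdistT (TGIndex.Mn d hL ⟨mT', k, hk, m⟩) y y')) :=
    fun _ _ => mul_nonneg (by positivity) (Real.exp_nonneg _)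
  have hmK : ∀ y y' : Tor (TGIndex.Mn d hL ⟨mT', k, hk, m⟩), 0 ≤ m₀ * ((L : ℝ) ^ k) ^ (-γ) * Real.exp (-(δ * tdistT (TGIndex.Mn d hL ⟨mT', k, hk, m⟩) y y')) :=
    fun _ _ => mul_nonneg (mul_nonneg hm₀.le hxθ) (Real.exp_nonneg _)
  -- the backward pieces at this index, tensored with `1_ι`
  have hBc : ∀ μ, HasMaj (BlockNorm.ofBlocks (unitTorusGeo L k (TGIndex.Mn d hL ⟨mT', k, hk, m⟩)) (liftBlk (blkFine L k (TGIndex.Mn d hL ⟨mT', k, hk, m⟩)) ι))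
      (BlockNorm.ofBlocks (unitTorusGeo L k (TGIndex.Mn d hL ⟨mT', k, hk, m⟩)) (liftBlk (blkFine L k (TGIndex.Mn d hL ⟨mT', k, hk, m⟩)) ι))
      (tensorId ι (bgrad ((L ^ k : ℕ) : ℝ) (bshiftEquiv (TGIndex.Mn d hL ⟨mT', k, hk, m⟩) (L ^ k) μ) ∘ₗ gOp (TGIndex.Mn d hL ⟨mT', k, hk, m⟩) (L ^ k) b))
      (fun y y' => (β + Cb) * Real.exp (-(δ * tdistT (TGIndex.Mn d hL ⟨mT', k, hk, m⟩) y y'))) := fun μ => by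
    rw [bgrad_comp_gOp_eq]
    refine hasMaj_tensorId ι hβK ((hasMaj_rate_mono hCb.le hδb' (Hb mT' k m hk μ).1).mono fun y y' => ?_)
    exact mul_le_mul_of_nonneg_right (by linarith) (Real.exp_nonneg _)
  have hBf : ∀ μ, HasMaj (BlockNorm.ofBlocks (unitTorusGeo L k (TGIndex.Mn d hL ⟨mT', k, hk, m⟩))
        (liftBlk (blkFine L k (TGIndex.Mn d hL ⟨mT', k, hk, m⟩) ∘ kingPrV L k m (TGIndex.Mn d hL ⟨mT', k, hk, m⟩)) ι))
      (BlockNorm.ofBlocks (unitTorusGeo L k (TGIndex.Mn d hL ⟨mT', k, hk, m⟩))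
        (liftBlk (blkFine L k (TGIndex.Mn d hL ⟨mT', k, hk, m⟩) ∘ kingPrV L k m (TGIndex.Mn d hL ⟨mT', k, hk, m⟩)) ι))
      (tensorId ι (bgrad ((L ^ m * L ^ k : ℕ) : ℝ) (bshiftEquiv (TGIndex.Mn d hL ⟨mT', k, hk, m⟩) (L ^ m * L ^ k) μ) ∘ₗ gOp (TGIndex.Mn d hL ⟨mT', k, hk, m⟩) (L ^ m * L ^ k) b))
      (fun y y' => (β + Cb) * Real.exp (-(δ * tdistT (TGIndex.Mn d hL ⟨mT', k, hk, m⟩) y y'))) := fun μ => by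
    rw [bgrad_comp_gOp_eq, blkFine_comp_kingPrV]
    refine hasMaj_tensorId ι hβK ((hasMaj_rate_mono hCb.le hδb' (Hb mT' k m hk μ).2).mono fun y y' => ?_)
    exact mul_le_mul_of_nonneg_right (by linarith) (Real.exp_nonneg _)
  have hBd : ∀ μ, HasMaj (BlockNorm.ofBlocks (unitTorusGeo L k (TGIndex.Mn d hL ⟨mT', k, hk, m⟩)) (liftBlk (blkFine L k (TGIndex.Mn d hL ⟨mT', k, hk, m⟩)) ι))
      (BlockNorm.ofBlocks (unitTorusGeo L k (TGIndex.Mn d hL ⟨mT', k, hk, m⟩))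
        (liftBlk (blkFine L k (TGIndex.Mn d hL ⟨mT', k, hk, m⟩) ∘ kingPrV L k m (TGIndex.Mn d hL ⟨mT', k, hk, m⟩)) ι))
      (idef (pull (liftMap (kingPrV L k m (TGIndex.Mn d hL ⟨mT', k, hk, m⟩)) ι)) (pull (liftMap (kingPrV L k m (TGIndex.Mn d hL ⟨mT', k, hk, m⟩)) ι))
        (tensorId ι (bgrad ((L ^ m * L ^ k : ℕ) : ℝ) (bshiftEquiv (TGIndex.Mn d hL ⟨mT', k, hk, m⟩) (L ^ m * L ^ k) μ) ∘ₗ gOp (TGIndex.Mn d hL ⟨mT', k, hk, m⟩) (L ^ m * L ^ k) b)) (tensorId ι (bgrad ((L ^ k : ℕ) : ℝ) (bshiftEquiv (TGIndex.Mn d hL ⟨mT', k, hk, m⟩) (L ^ k) μ) ∘ₗ gOp (TGIndex.Mn d hL ⟨mT', k, hk, m⟩) (L ^ k) b)))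
      (fun y y' => m₀ * ((L : ℝ) ^ k) ^ (-γ) * Real.exp (-(δ * tdistT (TGIndex.Mn d hL ⟨mT', k, hk, m⟩) y y'))) := fun μ => by
    rw [idef_tensorId, bgrad_comp_gOp_eq, bgrad_comp_gOp_eq, blkFine_comp_kingPrV]
    refine hasMaj_tensorId ι hmK ((Hbd mT' k m hk hL μ).mono fun y y' => ?_)
    rw [hcast]
    exact le_rate hCbd.le hCbdm hx1 hγ1 hδbd' (hd0 y y')
  refine ⟨hwide hG, fun j => ?_, hwide hG', fun j => ?_, hwide hD₃', hDG, fun j => ?_, hDD₃, fun ν' => hwide (hS ν'), fun ν' => hwide (hS' ν'), hSh, hSh',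
    fun U α₀ hreg μ => ?_⟩
  · cases j with
    | inl μ => exact hwide (hD μ)
    | inr μ => exact hBc μ
  · cases j with
    | inl μ => exact hwide (hD' μ)
    | inr μ => exact hBf μ
  · cases j with
    | inl μ => exact hDD μ
    | inr μ => exact hBd μ
  · -- the shift-defect row letter on the FORWARD rows: FILE 15 ★★ at `C_a := M_{Ā_μ∘e_μ⁻¹}`, `Ā_μ = (avgM₁ U).2 (inl μ)`
    have hreg' := hreg
    obtain ⟨⟨⟨hsc, -⟩, -⟩, -, -⟩ := hreg'
    obtain ⟨i₀⟩ := (inferInstance : Nonempty ι)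
    have hr0 : 0 ≤ c35 * (unitTorusGeo L k (TGIndex.Mn d hL ⟨mT', k, hk, m⟩)).M * α₀ := (abs_nonneg _).trans (hsc 0 i₀ i₀)
    obtain ⟨-, ha, -, -, -, -⟩ := rowLetters_of_reg335M (J := Fin (d + 1) ⊕ Fin (d + 1)) (ι := ι) (kingPrV L k m (TGIndex.Mn d hL ⟨mT', k, hk, m⟩)) hr0
      (reg335_coeffBgM₁_of_MBP₂ (Fin (d + 1)) ι hreg)
    obtain ⟨⟨-, -, -, -, hosc⟩, -⟩ := bpRowLetters_of_reg335M₂ (kingPrV L k m (TGIndex.Mn d hL ⟨mT', k, hk, m⟩)) hreg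
    set r : ℝ := c35 * (unitTorusGeo L k (TGIndex.Mn d hL ⟨mT', k, hk, m⟩)).M * α₀ * Fintype.card ι with hrdef
    have hr : 0 ≤ r := mul_nonneg hr0 (Nat.cast_nonneg _)
    have hrθ : 0 ≤ r * ((L : ℝ) ^ k) ^ (-γ) := mul_nonneg hr hxθ
    have hCa : HasMaj (BlockNorm.ofBlocks (unitTorusGeo L k (TGIndex.Mn d hL ⟨mT', k, hk, m⟩)) (liftBlk (blkFine L k (TGIndex.Mn d hL ⟨mT', k, hk, m⟩)) ι))
        (BlockNorm.ofBlocks (unitTorusGeo L k (TGIndex.Mn d hL ⟨mT', k, hk, m⟩)) (liftBlk (blkFine L k (TGIndex.Mn d hL ⟨mT', k, hk, m⟩)) ι))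
        (mmulOp ((avgM₁ (Fin (d + 1) ⊕ Fin (d + 1)) ι (kingPrV L k m (TGIndex.Mn d hL ⟨mT', k, hk, m⟩)) U).2 (Sum.inl μ) ∘
          ⇑(bshiftEquiv (TGIndex.Mn d hL ⟨mT', k, hk, m⟩) (L ^ k) μ).symm)) (diagK fun _ => r) :=
      hasMaj_mmulOp_translate (g := unitTorusGeo L k (TGIndex.Mn d hL ⟨mT', k, hk, m⟩)) (blkFine L k (TGIndex.Mn d hL ⟨mT', k, hk, m⟩))
        (τ := fun μ => bshiftEquiv (TGIndex.Mn d hL ⟨mT', k, hk, m⟩) (L ^ k) μ)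
        (A := fun μ => (avgM₁ (Fin (d + 1) ⊕ Fin (d + 1)) ι (kingPrV L k m (TGIndex.Mn d hL ⟨mT', k, hk, m⟩)) U).2 (Sum.inl μ)) hr (fun μ => ha (Sum.inl μ)) μ
    have hOsc : HasMaj (BlockNorm.ofBlocks (unitTorusGeo L k (TGIndex.Mn d hL ⟨mT', k, hk, m⟩)) (liftBlk (blkFine L k (TGIndex.Mn d hL ⟨mT', k, hk, m⟩)) ι))
        (BlockNorm.ofBlocks (unitTorusGeo L k (TGIndex.Mn d hL ⟨mT', k, hk, m⟩)) (liftBlk (blkFine L k (TGIndex.Mn d hL ⟨mT', k, hk, m⟩)) ι))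
        (mmulOp ((avgM₁ (Fin (d + 1) ⊕ Fin (d + 1)) ι (kingPrV L k m (TGIndex.Mn d hL ⟨mT', k, hk, m⟩)) U).2 (Sum.inl μ)) -
          mmulOp ((avgM₁ (Fin (d + 1) ⊕ Fin (d + 1)) ι (kingPrV L k m (TGIndex.Mn d hL ⟨mT', k, hk, m⟩)) U).2 (Sum.inl μ) ∘
            ⇑(bshiftEquiv (TGIndex.Mn d hL ⟨mT', k, hk, m⟩) (L ^ k) μ).symm)) (diagK fun _ => r * ((L : ℝ) ^ k) ^ (-γ)) :=
      hasMaj_mmulOp_sub_translate (g := unitTorusGeo L k (TGIndex.Mn d hL ⟨mT', k, hk, m⟩)) (blkFine L k (TGIndex.Mn d hL ⟨mT', k, hk, m⟩))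
        (τ := fun μ => bshiftEquiv (TGIndex.Mn d hL ⟨mT', k, hk, m⟩) (L ^ k) μ)
        (A := fun μ => (avgM₁ (Fin (d + 1) ⊕ Fin (d + 1)) ι (kingPrV L k m (TGIndex.Mn d hL ⟨mT', k, hk, m⟩)) U).2 (Sum.inl μ)) μ hrθ (hosc μ)
    have hCaS : pull ⇑(liftEquiv (bshiftEquiv (TGIndex.Mn d hL ⟨mT', k, hk, m⟩) (L ^ k) μ) ι) ∘ₗ
        mmulOp ((avgM₁ (Fin (d + 1) ⊕ Fin (d + 1)) ι (kingPrV L k m (TGIndex.Mn d hL ⟨mT', k, hk, m⟩)) U).2 (Sum.inl μ) ∘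
          ⇑(bshiftEquiv (TGIndex.Mn d hL ⟨mT', k, hk, m⟩) (L ^ k) μ).symm) =
        mmulOp ((avgM₁ (Fin (d + 1) ⊕ Fin (d + 1)) ι (kingPrV L k m (TGIndex.Mn d hL ⟨mT', k, hk, m⟩)) U).2 (Sum.inl μ)) ∘ₗ
          pull ⇑(liftEquiv (bshiftEquiv (TGIndex.Mn d hL ⟨mT', k, hk, m⟩) (L ^ k) μ) ι) :=
      pull_comp_mmulOp_translate _ _
    have key := H4 mT' k m hk hL μ _ _ r (r * ((L : ℝ) ^ k) ^ (-γ)) hr hrθ hCaS hCa hOsc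
    refine key.mono fun y y' => ?_
    rw [hcast]
    have hE : Real.exp (-(δ₄ * tdistT (TGIndex.Mn d hL ⟨mT', k, hk, m⟩) y y')) ≤ Real.exp (-(δ * tdistT (TGIndex.Mn d hL ⟨mT', k, hk, m⟩) y y')) :=
      Real.exp_le_exp.mpr (by nlinarith [hd0 y y'])
    have heq : C₄ * (r * ((L : ℝ) ^ k) ^ (-γ) + r * ((L : ℝ) ^ k) ^ (-γ)) = 2 * C₄ * r * ((L : ℝ) ^ k) ^ (-γ) := by ring
    calc C₄ * (r * ((L : ℝ) ^ k) ^ (-γ) + r * ((L : ℝ) ^ k) ^ (-γ)) * Real.exp (-(δ₄ * tdistT (TGIndex.Mn d hL ⟨mT', k, hk, m⟩) y y'))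
        ≤ C₄ * (r * ((L : ℝ) ^ k) ^ (-γ) + r * ((L : ℝ) ^ k) ^ (-γ)) * Real.exp (-(δ * tdistT (TGIndex.Mn d hL ⟨mT', k, hk, m⟩) y y')) :=
          mul_le_mul_of_nonneg_left hE (by positivity)
      _ = 2 * C₄ * r * ((L : ℝ) ^ k) ^ (-γ) * Real.exp (-(δ * tdistT (TGIndex.Mn d hL ⟨mT', k, hk, m⟩) y y')) := by rw [heq]

end Letters

/-! ## §3 ★★★ `NE2PlusOperator` BY NAME for `gOp ⊗ 1_𝔤` dressed by a LIVE two-sided matrix-coefficient background -/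

section Node

variable (d) (ι : Type) [Fintype ι] [DecidableEq ι] [Nonempty ι]

/-- ★★★ **`T4EtaRate.NE2PlusOperator` BY NAME FOR BAŁABAN's FULL `U ≡ 1` PROPAGATOR ⊗ 1_𝔤 DRESSED BY A LIVE TWO-SIDED NON-ABELIAN FIRST-ORDER BACKGROUND, MODULO ONLY THE `U ≡ 1`
ENTRY-2 η-DEFECT** — FILE 20 `ne2PlusOperator_byParts_matrix₂` at the realised family, every other `U ≡ 1` input a tree theorem (§2). [cite: Balaban1985BackgroundPropagators, Thm 3.1 p.397 (quantifier template); (3.35)–(3.36) p.396, (3.42) p.397, (3.52) p.400, (3.63)–(3.65) p.402 (shapes, mechanism); Balaban1984PropagatorsI, Prop. 1.2 (1.110)–(1.111) p.35; Balaban1984PropagatorsII, (2.156) p.250] -/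
theorem ne2PlusOperator_fullGM₂_byParts_of_entry2 (hLodd : Odd L) (hL2 : 2 ≤ L) (hL : Odd L ∧ 1 < L) {b : ℝ} (hb : 0 < b) (c35 : ℝ) (hc35 : 0 < c35)
    {γ : ℝ} (hγ0 : 0 < γ) (hγ1 : γ ≤ 1 / 16) {B₂ δ₂ : ℝ} (hB₂ : 0 ≤ B₂) (hδ₂ : 0 < δ₂)
    (h2 : ∀ (i : TGIndex) (ν : Fin (d + 1)),
      HasMaj (BlockNorm.ofBlocks (unitTorusGeo L i.k (TGIndex.Mn d hL i)) (blkFine L i.k (TGIndex.Mn d hL i)))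
        (BlockNorm.ofBlocks (unitTorusGeo L i.k (TGIndex.Mn d hL i)) (blkFine L i.k (TGIndex.Mn d hL i) ∘ kingPrV L i.k i.m (TGIndex.Mn d hL i)))
        (idef (pull (kingPrV L i.k i.m (TGIndex.Mn d hL i))) (pull (kingPrV L i.k i.m (TGIndex.Mn d hL i)))
          (gOp (TGIndex.Mn d hL i) (L ^ i.m * L ^ i.k) b ∘ₗ fgradAdj ((L ^ i.m * L ^ i.k : ℕ) : ℝ) (bshiftEquiv (TGIndex.Mn d hL i) (L ^ i.m * L ^ i.k) ν))
          (gOp (TGIndex.Mn d hL i) (L ^ i.k) b ∘ₗ fgradAdj ((L ^ i.k : ℕ) : ℝ) (bshiftEquiv (TGIndex.Mn d hL i) (L ^ i.k) ν)))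
        (fun y y' => B₂ * ((L : ℝ) ^ i.k) ^ (-γ) * Real.exp (-(δ₂ * tdistT (TGIndex.Mn d hL i) y y')))) :
    NE2PlusOperator c35 (fgInstanceM₂ d ι hL γ) (fgFamilyM₂ d ι hL b γ) := by
  obtain ⟨δ, β, m₀, cT, mT, hδ, hδδ₂, hβ, hm₀, hBm, hcT, hmT, H⟩ := uniform_layer_fullGM₂ d ι hLodd hL2 hL hb hγ0 hγ1 c35 hδ₂ hB₂
  have hL0 : L ≠ 0 := by omega
  have hLr : (0 : ℝ) < (L : ℝ) := by exact_mod_cast (show 0 < L by omega)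
  have hLr1 : (1 : ℝ) ≤ (L : ℝ) := by exact_mod_cast (show 1 ≤ L by omega)
  have hσ : 0 < δ / 12 := by positivity
  have hDS : ∀ (i : TGIndex × Fin (d + 1)) (ν : Fin (d + 1)),
      HasMaj (BlockNorm.ofBlocks (unitTorusGeo L i.1.k (TGIndex.Mn d hL i.1)) (liftBlk (blkFine L i.1.k (TGIndex.Mn d hL i.1)) ι))
        (BlockNorm.ofBlocks (unitTorusGeo L i.1.k (TGIndex.Mn d hL i.1)) (liftBlk (blkFine L i.1.k (TGIndex.Mn d hL i.1) ∘ kingPrV L i.1.k i.1.m (TGIndex.Mn d hL i.1)) ι))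
        (idef (pull (liftMap (kingPrV L i.1.k i.1.m (TGIndex.Mn d hL i.1)) ι)) (pull (liftMap (kingPrV L i.1.k i.1.m (TGIndex.Mn d hL i.1)) ι))
          (tensorId ι (gOp (TGIndex.Mn d hL i.1) (L ^ i.1.m * L ^ i.1.k) b) ∘ₗ
            fgradAdj ((L ^ i.1.m * L ^ i.1.k : ℕ) : ℝ) (liftEquiv (bshiftEquiv (TGIndex.Mn d hL i.1) (L ^ i.1.m * L ^ i.1.k) ν) ι))
          (tensorId ι (gOp (TGIndex.Mn d hL i.1) (L ^ i.1.k) b) ∘ₗ fgradAdj ((L ^ i.1.k : ℕ) : ℝ) (liftEquiv (bshiftEquiv (TGIndex.Mn d hL i.1) (L ^ i.1.k) ν) ι)))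
        (fun y y' => m₀ * ((L : ℝ) ^ i.1.k) ^ (-γ) * Real.exp (-(δ * (unitTorusGeo L i.1.k (TGIndex.Mn d hL i.1)).dist y y'))) := fun i ν => by
    rw [idef_comp_fgradAdj_liftEquiv]
    exact hasMaj_tensorId ι (fun _ _ => mul_nonneg (mul_nonneg hm₀.le (Real.rpow_nonneg (pow_nonneg hLr.le _) _)) (Real.exp_nonneg _))
      ((h2 i.1 ν).mono fun y y' => le_rate hB₂ hBm (one_le_pow₀ hLr1) le_rfl hδδ₂ (tdistT_nonneg _ _ _))
  exact ne2PlusOperator_byParts_matrix₂ (I := TGIndex × Fin (d + 1)) (J := Fin (d + 1)) (ι := ι) (fun i => unitTorusGeo L i.1.k (TGIndex.Mn d hL i.1))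
    (fun i => Tor (fine (L ^ i.1.k) (TGIndex.Mn d hL i.1)) × Fin (d + 1)) (fun i => Tor (fine (L ^ i.1.m * L ^ i.1.k) (TGIndex.Mn d hL i.1)) × Fin (d + 1))
    (fun i => blkFine L i.1.k (TGIndex.Mn d hL i.1)) (fun i => kingPrV L i.1.k i.1.m (TGIndex.Mn d hL i.1))
    (fun i μ => bshiftEquiv (TGIndex.Mn d hL i.1) (L ^ i.1.k) μ) (fun i μ => bshiftEquiv (TGIndex.Mn d hL i.1) (L ^ i.1.m * L ^ i.1.k) μ)
    (fun i => ((L ^ i.1.k : ℕ) : ℝ)) (fun i => ((L ^ i.1.m * L ^ i.1.k : ℕ) : ℝ)) (fun i => i.1.m) (fun _ => Nat.cast_ne_zero.mpr hL0)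
    (fun i => ((L : ℝ) ^ i.1.k) ^ (-γ)) (fun i => ((L : ℝ) ^ i.1.k) ^ (-γ)) (fun i => i.2)
    (fun i => tensorId ι (gOp (TGIndex.Mn d hL i.1) (L ^ i.1.k) b))
    (fun i => tensorId ι (symbOp (TGIndex.Mn d hL i.1) (L ^ i.1.k) (sLap (TGIndex.Mn d hL i.1) (L ^ i.1.k) ((L ^ i.1.k : ℕ) : ℝ)) ∘ₗ gOp (TGIndex.Mn d hL i.1) (L ^ i.1.k) b))
    (fun i => dPiecesM₂ d ι (TGIndex.Mn d hL i.1) (L ^ i.1.k) b)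
    (fun i => tensorId ι (gOp (TGIndex.Mn d hL i.1) (L ^ i.1.m * L ^ i.1.k) b))
    (fun i => tensorId ι (symbOp (TGIndex.Mn d hL i.1) (L ^ i.1.m * L ^ i.1.k) (sLap (TGIndex.Mn d hL i.1) (L ^ i.1.m * L ^ i.1.k) ((L ^ i.1.m * L ^ i.1.k : ℕ) : ℝ)) ∘ₗ
      gOp (TGIndex.Mn d hL i.1) (L ^ i.1.m * L ^ i.1.k) b))
    (fun i => dPiecesM₂ d ι (TGIndex.Mn d hL i.1) (L ^ i.1.m * L ^ i.1.k) b)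
    c35 hc35 (fun i => triangle254_unitTorusGeo L i.1.k (TGIndex.Mn d hL i.1)) (fun i a c => tdistT_nonneg _ _ _) (fun i y => tdistT_self _ y) hσ.le
    (B4Sect5Proof.latticeConst_nonneg (d + 1) hσ.le) (fun i => rowSum_unitTorusGeo L i.1.k (TGIndex.Mn d hL i.1) hσ)
    (fun i => inv_pos.mpr (pow_pos hLr _)) (fun i => hLr) (fun i y => (unitTorusGeo_len L i.1.k (TGIndex.Mn d hL i.1) hL0 y).symm.le)
    (by linarith) hβ.le hm₀.le hγ0 (fun i => Real.rpow_nonneg (pow_nonneg hLr.le _) _) (fun i y => le_rfl) hcT.le hmT.le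
    (fun i => (H i).1) (fun i => (H i).2.1) (fun i => (H i).2.2.1) (fun i => (H i).2.2.2.1) (fun i => (H i).2.2.2.2.1) (fun i => (H i).2.2.2.2.2.1)
    (fun i => (H i).2.2.2.2.2.2.1) (fun i => (H i).2.2.2.2.2.2.2.1) (fun i => (H i).2.2.2.2.2.2.2.2.1) (fun i => (H i).2.2.2.2.2.2.2.2.2.1)
    (fun i ν => hDS i ν) (fun i => (H i).2.2.2.2.2.2.2.2.2.2.1) (fun i => (H i).2.2.2.2.2.2.2.2.2.2.2.1) (fun i => (H i).2.2.2.2.2.2.2.2.2.2.2.2)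

/-- ★★★ **`T4EtaRate.NE2PlusOperator` BY NAME, NO DISPLAYED BINDER: Bałaban's FULL `U ≡ 1` Landau-gauge propagator acting componentwise on `𝔤 ≅ ℝ^ι`-valued 1-forms (`G ⊗ 1_𝔤`) on the
torus family of record, dressed by a LIVE TWO-SIDED NON-ABELIAN first-order background `M_C + Σ_μ[M_{A_μ}∇_μ + M_{B_μ}∇⁻_μ]` (the shape of Bałaban's (3.52) `V′₁(A)` in coordinates: forward
AND backward bond orientations; FILE 19's carrier `coeffBgMBP₂`), ALL FOUR (3.42) entries CONSTRUCTED (entry 2 by parts = `E₀∘∇_ν*` by FILE 18's identification, `dPiecesM₂_inl` ∕ `_inr`),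
rate exponent `γ = 1∕(8(d+1))` (`d ≥ 1`)** — fed with dag-n15-a's ENTRY 2 (part 71).  Every input is a tree theorem.  MODEL-LEVEL in the background species (free matrix coefficient fields on
both orientations, entrywise-linearised transport), GENUINE in the propagator; NO (3.44) mixed letter. [cite: Balaban1985BackgroundPropagators, Thm 3.1 p.397 (quantifier template); (3.35)–(3.36) p.396, (3.42) p.397, (3.52) p.400, (3.63)–(3.65) p.402 (shapes, mechanism); Balaban1984PropagatorsI, Prop. 1.2 (1.110)–(1.111) p.35; Balaban1984PropagatorsII, (2.156) p.250] -/
theorem ne2PlusOperator_fullGM₂_byParts (hd1 : 1 ≤ d) (hLodd : Odd L) (hL2 : 2 ≤ L) (hL : Odd L ∧ 1 < L) {b : ℝ} (hb : 0 < b) (c35 : ℝ) (hc35 : 0 < c35) :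
    NE2PlusOperator c35 (fgInstanceM₂ d ι hL (1 / (8 * ((d : ℝ) + 1)))) (fgFamilyM₂ d ι hL b (1 / (8 * ((d : ℝ) + 1)))) := by
  obtain ⟨δ₂, B₂, hδ₂, hB₂, H2⟩ := hasMaj_twoGridDefect_div (d := d) hLodd hL2 hb
  have hd1' : (1 : ℝ) ≤ (d : ℝ) := by exact_mod_cast hd1
  have hγ0 : 0 < 1 / (8 * ((d : ℝ) + 1)) := by positivity
  have hγ1 : 1 / (8 * ((d : ℝ) + 1)) ≤ 1 / 16 := one_div_le_one_div_of_le (by norm_num) (by nlinarith)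
  refine ne2PlusOperator_fullGM₂_byParts_of_entry2 d ι hLodd hL2 hL hb c35 hc35 hγ0 hγ1 hB₂.le hδ₂ fun i ν => ?_
  have h := H2 i.mT i.k i.m i.one_le hL ν
  rw [← symbOp_sTinv_sub_one_eq, ← symbOp_sTinv_sub_one_eq, blkFine_comp_kingPrV]
  refine h.mono fun y y' => le_of_eq ?_
  rw [show ((L ^ i.k : ℕ) : ℝ) = (L : ℝ) ^ i.k by push_cast; ring]
  exact rfl

/-- The four-dimensional two-sided instance (`d + 1 = 4`, `γ = 1∕32`). [cite: Balaban1985BackgroundPropagators, Thm 3.1 p.397 (quantifier template)] -/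
theorem ne2PlusOperator_fullGM₂_byParts_dim4 (hLodd : Odd L) (hL2 : 2 ≤ L) (hL : Odd L ∧ 1 < L) {b : ℝ} (hb : 0 < b) (c35 : ℝ) (hc35 : 0 < c35) :
    NE2PlusOperator c35 (fgInstanceM₂ 3 ι hL (1 / (8 * ((3 : ℕ) : ℝ) + 8))) (fgFamilyM₂ 3 ι hL b (1 / (8 * ((3 : ℕ) : ℝ) + 8))) := by
  have h := ne2PlusOperator_fullGM₂_byParts 3 ι (by norm_num) hLodd hL2 hL hb c35 hc35
  rw [show (8 : ℝ) * ((3 : ℕ) : ℝ) + 8 = 8 * (((3 : ℕ) : ℝ) + 1) by ring]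
  exact h

end Node

end Summit.QuantumFields.YangMills.BalabanUVNodes.N15.BackgroundLayer

end
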